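import Literature.MathematicalPhysics.QuantumFieldTheory.Balaban1983to89.B9Thm313WholeHolder
import Literature.MathematicalPhysics.QuantumFieldTheory.Balaban1983to89.B9Thm312WholeBlocksRel

/-!
# `Balaban1983to89.B9Thm313WholeL2G` — [B9] Theorem 3.13 (p. 426): the block-L² lines (3.46)₃,₄,₅ of 𝔊 = 𝔓G₁ at one member and one
# configuration, by (3.153) in r1-g6's weighted block-L² classes — letters of printed shape for the (3.152)–(3.153) pieces, r1's Neumann
# bookkeeping for the G₁-entries E·G₁·F, and `B9Thm313Whole.hasMaj_frakG_classes`

T. Bałaban, *Propagators for lattice gauge theories in a background field*, Commun. Math. Phys. **99** (1985) 389–434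
[`Balaban1985BackgroundPropagators`, "B9"]; [4] = T. Bałaban, *Propagators and renormalization transformations for lattice
gauge theories. II*, Commun. Math. Phys. **96** (1984) 223–250 [`Balaban1984PropagatorsII`].

statement-level skeleton of published theorems with citation tags; proofs where landed; nothing here is a claim about the
Yang–Mills mass gap

THE PRINTED LOCI.  p. 426: *"𝔊 = 𝔓G₁ (3.153) … The formulas (3.147), (3.153) permit us to reduce properties of the operators 𝔓, 𝔊 to the
corresponding properties of the operators G′, (Q′G′²Q′*)⁻¹, G₁, (QG₁Q*)⁻¹. For example the inequalities (3.132), (3.138) imply Theorem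
3.13."*; (3.152): *"RD*G₁ = RG′D*"*; (3.46) p. 398: *"‖hΔ_UGλ‖₂, ‖h∇_UG∇*_Uμ‖₂, ‖hGΔ_Uλ‖₂ ≦ B₀[1, 1, 1]·sup|h|·e^{−δ₀d(y,y′)}‖·‖₂"* (the lines
n = 3, 4, 5) and the remark after (3.47) (*"we may replace the factor (Lʲη)^α by (Lʲη)^β(L^{j′}η)^γ with β + γ = α"*).

WHAT THIS FILE DOES (one member, one U; everything generic over the `Ops` signature).
* §1 `Letters313L2 𝔬 Lap R₀ H₀ B₄ δ U` (Prop structure, printed shape, NOTHING ASSERTED): block-L² bounds ‖1_{Δ(y)}·T·1_{Δ(y′)}‖₂→₂ ≦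
  B₄·(scale factors)·e^{−δd(y,y′)} of the (3.153) pieces which print treats as known — G₀D, Δ_UG₀D, ∇_UG₀D (the gauge-mode derivative D
  of [4] (2.26)), G₀Q*, Δ_UG₀Q*, ∇_UG₀Q* ((3.126)), RD*G₁𝒳 for 𝒳 ∈ {I, ∇*_U, Δ_U} ((3.152) + Theorem 3.1 for G′ + (3.49)), C₁ = (QG₁Q*)⁻¹
  ((3.132)) and the local averaging Q — with the scale powers split between y and y′ per the p. 398 remark; `letters313L2_mono`.
* §2 `entry_l2w_of_step`: r1-g6's `B9SectDL2Decay.thm312_entry_l2` (the block-L² Neumann bookkeeping of (3.130)∕(3.138)) read as a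
  majorant between the weighted block-L² classes `l2w`, from Theorem 3.3 (3.46) for G₀ (`Thm33G0L2`) and the step's L² bound; constants
  `constP`, `constKp`, `constG46` (+ order lemmas).
* §3 ★ `GG_l2bd_entry4` ((3.46)₄ of 𝔊: ∇_U𝔊∇*_U, dimensionless), ★ `GG_l2bd_entry3` ((3.46)₃: Δ_U𝔊, after the scale transfer (2.60)),
  ★ `GG_l2bd_entry5` ((3.46)₅: 𝔊Δ_U): E𝔊F = EG₁F − (EG₁D)(RD*G₁F) − (EG₁Q*)(C₁QG₁F) (`B9Thm313WholeHolder.E_GG_eq ∕ E_GG_F_eq`,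
  `B9Thm313Whole.GG_comp_eq`) composed by `B9Thm313Whole.hasMaj_frakG_classes` in the `l2w` classes, [4] (2.61) as the row sum.

HONEST SCOPE.  Nothing of [B9] or [4] is asserted: Theorem 3.3 for G₀, the step's L² bound, the letters, the identities and (2.60)–(2.61)
are HYPOTHESES of printed ∕ definitional shape (located gap G-B9-16); the content is bookkeeping, kernel-checked.  NOT a node discharge,
NOT summit progress; one finite lattice at a time; nothing continuum, nothing about the mass gap.  Cell `pub-ymgap` (HUMAN RULING D-0062),
Track A node N06 [B9], N06-ASSIGNMENT v1 row 21 (bundle F7), seat `pub-ymgap-dag-n06-l` (g4), 2026-08-27.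
-/

namespace Literature.MathematicalPhysics.QuantumFieldTheory.Balaban1983to89.B9Thm313WholeL2G

open Literature.MathematicalPhysics.QuantumFieldTheory.Balaban1983to89
open Finset B6RandomWalk B6RandomWalkHom B9Thm34Ext B9Thm37GlueCor36 B11SectG B9SectDSup B9SectDL2Decay
open B9Thm37AllNorms B9Thm37AllNormsInstances B9Thm312Whole B9Thm312WholeLeaf B9Thm312WholeLeft B9Thm313Whole B9Thm313WholeLeft
open B9Ineq347 B9Thm312WholeClasses B9Thm312WholeL2 B9Thm313WholeHolder

noncomputable section

section L2G

variable {g : B9.Geometry} {B : B9.Backgrounds} {X Y Z W : Type} [Fintype X] [Fintype Y] [Fintype Z] [Fintype W]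
  [Fintype g.Site]
variable {R₀ : ℝ} {H₀ : Prop}

/-! ## §1 The letters of (3.152)–(3.153) in the block-L² classes (printed shape; nothing asserted) -/

/-- **THE BLOCK-L² LETTERS OF THEOREM 3.13's REDUCTION AT U** (p. 426: *"The formulas (3.147), (3.153) permit us to reduce properties of the
operators 𝔓, 𝔊 to the corresponding properties of the operators G′, (Q′G′²Q′*)⁻¹, G₁, (QG₁Q*)⁻¹"*), as block-L² bounds
‖1_{Δ(y)}T1_{Δ(y′)}‖₂→₂ ≦ B₄·(scale factors)·e^{−δd(y,y′)} in the convention of (3.46) with the scale powers split between y and y′ (p. 398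
remark): `gDv`, `lapGDv`, `dGDv` — G₀D, Δ_UG₀D, ∇_UG₀D with the gauge-mode derivative D of DRD* ([4] (2.26); factors Lʲη, (Lʲη)⁻¹, 1);
`gQs`, `lapGQs`, `dGQs` — G₀Q*, Δ_UG₀Q*, ∇_UG₀Q* (the H₀-type entries of (3.126); factors LʲηL^{j′}η, L^{j′}η∕Lʲη, L^{j′}η); `rgdI`, `rgdDs`,
`rgdLap` — RD*G₁𝒳 = RG′D*𝒳 ((3.152); Theorem 3.1 for G′ and (3.49) for R) for 𝒳 = I, ∇*_U, Δ_U (factors L^{j′}η, 1, (L^{j′}η)⁻¹); `c1` —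
C₁ = (QG₁Q*)⁻¹ with (3.132) (factor (Lʲη)⁻¹(L^{j′}η)⁻¹); `q` — the local averaging operator Q (dimensionless, split Lʲη∕L^{j′}η).
NOTHING ASSERTED: these are the instance's (Theorem 3.1, (3.49), (3.126), (3.132), (3.152)).
[cite: Balaban1985BackgroundPropagators, Thm 3.13 p.426 + (3.152)–(3.153) p.426 + (3.132) p.422 + (3.126) p.420 + (3.46) p.398 + p.398 (remark after (3.47)); Balaban1984PropagatorsII, (2.26) p.228] -/
structure Letters313L2 (𝔬 : Ops g B X Y Z W) (Lap : B.Cfg → Module.End ℝ (X → ℝ)) (R₀ : ℝ) (H₀ : Prop) (B₄ δ : ℝ)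
    (U : B.Cfg) : Prop where
  gDv : BlockBd (g := toB6 g R₀ H₀) 𝔬.blkW 𝔬.blk (𝔬.G0 U ∘ₗ 𝔬.Dv U)
    (fun (y y' : g.Site) => B₄ * g.len y * Real.exp (-(δ * g.dist y y')))
  lapGDv : BlockBd (g := toB6 g R₀ H₀) 𝔬.blkW 𝔬.blk (Lap U ∘ₗ 𝔬.G0 U ∘ₗ 𝔬.Dv U)
    (fun (y y' : g.Site) => B₄ * (g.len y)⁻¹ * Real.exp (-(δ * g.dist y y')))
  dGDv : BlockBd (g := toB6 g R₀ H₀) 𝔬.blkW 𝔬.blkY (𝔬.D U ∘ₗ 𝔬.G0 U ∘ₗ 𝔬.Dv U)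
    (fun (y y' : g.Site) => B₄ * Real.exp (-(δ * g.dist y y')))
  gQs : BlockBd (g := toB6 g R₀ H₀) 𝔬.blkZ 𝔬.blk (𝔬.G0 U ∘ₗ 𝔬.Qstar U)
    (fun (y y' : g.Site) => B₄ * g.len y * g.len y' * Real.exp (-(δ * g.dist y y')))
  lapGQs : BlockBd (g := toB6 g R₀ H₀) 𝔬.blkZ 𝔬.blk (Lap U ∘ₗ 𝔬.G0 U ∘ₗ 𝔬.Qstar U)
    (fun (y y' : g.Site) => B₄ * ((g.len y)⁻¹ * g.len y') * Real.exp (-(δ * g.dist y y')))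
  dGQs : BlockBd (g := toB6 g R₀ H₀) 𝔬.blkZ 𝔬.blkY (𝔬.D U ∘ₗ 𝔬.G0 U ∘ₗ 𝔬.Qstar U)
    (fun (y y' : g.Site) => B₄ * g.len y' * Real.exp (-(δ * g.dist y y')))
  rgdI : BlockBd (g := toB6 g R₀ H₀) 𝔬.blk 𝔬.blkW (𝔬.R U ∘ₗ 𝔬.Dvstar U ∘ₗ 𝔬.G1 U ∘ₗ LinearMap.id)
    (fun (y y' : g.Site) => B₄ * g.len y' * Real.exp (-(δ * g.dist y y')))
  rgdDs : BlockBd (g := toB6 g R₀ H₀) 𝔬.blkY 𝔬.blkW (𝔬.R U ∘ₗ 𝔬.Dvstar U ∘ₗ 𝔬.G1 U ∘ₗ 𝔬.Dstar U)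
    (fun (y y' : g.Site) => B₄ * Real.exp (-(δ * g.dist y y')))
  rgdLap : BlockBd (g := toB6 g R₀ H₀) 𝔬.blk 𝔬.blkW (𝔬.R U ∘ₗ 𝔬.Dvstar U ∘ₗ 𝔬.G1 U ∘ₗ Lap U)
    (fun (y y' : g.Site) => B₄ * (g.len y')⁻¹ * Real.exp (-(δ * g.dist y y')))
  c1 : BlockBd (g := toB6 g R₀ H₀) 𝔬.blkZ 𝔬.blkZ (𝔬.C1 U)
    (fun (y y' : g.Site) => B₄ * (g.len y)⁻¹ * (g.len y')⁻¹ * Real.exp (-(δ * g.dist y y')))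
  q : BlockBd (g := toB6 g R₀ H₀) 𝔬.blk 𝔬.blkZ (𝔬.Q U)
    (fun (y y' : g.Site) => B₄ * (g.len y * (g.len y')⁻¹) * Real.exp (-(δ * g.dist y y')))

/-- the letters at a slower rate (e^{−δd} ≦ e^{−δ′d} for δ′ ≦ δ, d ≧ 0). [cite: Balaban1985BackgroundPropagators, (3.46) p.398 (bookkeeping)] -/
theorem letters313L2_mono {𝔬 : Ops g B X Y Z W} {Lap : B.Cfg → Module.End ℝ (X → ℝ)} {B₄ δ δ' : ℝ} {U : B.Cfg}
    (hG : GeoOK g) (hB₄ : 0 ≤ B₄) (hδ : δ' ≤ δ) (h : Letters313L2 𝔬 Lap R₀ H₀ B₄ δ U) :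
    Letters313L2 𝔬 Lap R₀ H₀ B₄ δ' U := by
  have hexp : ∀ y y' : g.Site, Real.exp (-(δ * g.dist y y')) ≤ Real.exp (-(δ' * g.dist y y')) := fun y y' =>
    Real.exp_le_exp.mpr (neg_le_neg (mul_le_mul_of_nonneg_right hδ (hG.dnn y y')))
  have hl : ∀ y : g.Site, 0 ≤ g.len y := hG.lenle
  have hli : ∀ y : g.Site, 0 ≤ (g.len y)⁻¹ := fun y => inv_nonneg.mpr (hl y)
  exact
    { gDv := h.gDv.mono fun y y' => mul_le_mul_of_nonneg_left (hexp y y') (mul_nonneg hB₄ (hl y))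
      lapGDv := h.lapGDv.mono fun y y' => mul_le_mul_of_nonneg_left (hexp y y') (mul_nonneg hB₄ (hli y))
      dGDv := h.dGDv.mono fun y y' => mul_le_mul_of_nonneg_left (hexp y y') hB₄
      gQs := h.gQs.mono fun y y' => mul_le_mul_of_nonneg_left (hexp y y') (mul_nonneg (mul_nonneg hB₄ (hl y)) (hl y'))
      lapGQs := h.lapGQs.mono fun y y' => mul_le_mul_of_nonneg_left (hexp y y') (mul_nonneg hB₄ (mul_nonneg (hli y) (hl y')))
      dGQs := h.dGQs.mono fun y y' => mul_le_mul_of_nonneg_left (hexp y y') (mul_nonneg hB₄ (hl y'))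
      rgdI := h.rgdI.mono fun y y' => mul_le_mul_of_nonneg_left (hexp y y') (mul_nonneg hB₄ (hl y'))
      rgdDs := h.rgdDs.mono fun y y' => mul_le_mul_of_nonneg_left (hexp y y') hB₄
      rgdLap := h.rgdLap.mono fun y y' => mul_le_mul_of_nonneg_left (hexp y y') (mul_nonneg hB₄ (hli y'))
      c1 := h.c1.mono fun y y' => mul_le_mul_of_nonneg_left (hexp y y') (mul_nonneg (mul_nonneg hB₄ (hli y)) (hli y'))
      q := h.q.mono fun y y' => mul_le_mul_of_nonneg_left (hexp y y') (mul_nonneg hB₄ (mul_nonneg (hl y) (hli y'))) }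

/-! ## §2 One G₁-entry E·G₁·F in the weighted block-L² classes, and the constants -/

/-- The constant of one entry E·A·F of r1's Neumann bookkeeping: a_EF + a_E·θ·a_S(1 − B₂θc²)⁻¹·c².
[cite: Balaban1985BackgroundPropagators, Thm 3.12 p.423 (bookkeeping)] -/
def constP (B₂ θ c aS aE aEF : ℝ) : ℝ := aEF + aE * (θ * (aS * (1 - B₂ * θ * c * c)⁻¹) * c) * c

/-- The uniform constant of the pieces: `constP` at a_S = a_E = a_EF = B₂ + B₄. [cite: Balaban1985BackgroundPropagators, Thm 3.13 p.426 (bookkeeping)] -/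
def constKp (B₂ B₄ θ c : ℝ) : ℝ := constP B₂ θ c (B₂ + B₄) (B₂ + B₄) (B₂ + B₄)

/-- The constant of `hasMaj_frakG_classes` with all letters at K and the composite QG₁F at K²c: K + K²c + K·(K·(K²c)·c)·c.
[cite: Balaban1985BackgroundPropagators, Thm 3.13 p.426 (bookkeeping)] -/
def constG46 (K c : ℝ) : ℝ := K + K * K * c + K * (K * (K * K * c) * c) * c

omit [Fintype X] [Fintype Y] [Fintype Z] [Fintype W] [Fintype g.Site] in
/-- `constP` is non-negative and monotone in (a_S, a_E, a_EF) for non-negative data. [cite: Balaban1985BackgroundPropagators, Thm 3.12 p.423 (bookkeeping)] -/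
theorem constP_nonneg_le {B₂ θ c aS aE aEF S : ℝ} (hθ : 0 ≤ θ) (hc : 0 ≤ c) (hq : B₂ * θ * c * c < 1) (haS : 0 ≤ aS)
    (haE : 0 ≤ aE) (haEF : 0 ≤ aEF) (hS : aS ≤ S) (hE : aE ≤ S) (hEF : aEF ≤ S) :
    0 ≤ constP B₂ θ c aS aE aEF ∧ constP B₂ θ c aS aE aEF ≤ constP B₂ θ c S S S := by
  have hq1 : 0 ≤ (1 - B₂ * θ * c * c)⁻¹ := inv_nonneg.mpr (by linarith)
  have hS0 : 0 ≤ S := haS.trans hS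
  unfold constP
  refine ⟨add_nonneg haEF (mul_nonneg (mul_nonneg haE (mul_nonneg (mul_nonneg hθ (mul_nonneg haS hq1)) hc)) hc), ?_⟩
  have h1 : θ * (aS * (1 - B₂ * θ * c * c)⁻¹) * c ≤ θ * (S * (1 - B₂ * θ * c * c)⁻¹) * c := by gcongr
  have h2 : aE * (θ * (aS * (1 - B₂ * θ * c * c)⁻¹) * c) * c ≤ S * (θ * (S * (1 - B₂ * θ * c * c)⁻¹) * c) * c := by
    have h0 : 0 ≤ θ * (aS * (1 - B₂ * θ * c * c)⁻¹) * c := mul_nonneg (mul_nonneg hθ (mul_nonneg haS hq1)) hc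
    gcongr
  linarith

omit [Fintype X] [Fintype Y] [Fintype Z] [Fintype W] [Fintype g.Site] in
/-- `constG46` is non-negative for non-negative data. [cite: Balaban1985BackgroundPropagators, Thm 3.13 p.426 (bookkeeping)] -/
theorem constG46_nonneg {K c : ℝ} (hK : 0 ≤ K) (hc : 0 ≤ c) : 0 ≤ constG46 K c := by
  unfold constG46; positivity

omit [Fintype X] [Fintype Y] [Fintype Z] [Fintype W] [Fintype g.Site] in
/-- `constG46` is monotone in K ≧ 0 (c ≧ 0). [cite: Balaban1985BackgroundPropagators, Thm 3.13 p.426 (bookkeeping)] -/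
theorem constG46_mono {K K' c : ℝ} (hK : 0 ≤ K) (hKK' : K ≤ K') (hc : 0 ≤ c) : constG46 K c ≤ constG46 K' c := by
  have hK' : 0 ≤ K' := hK.trans hKK'
  unfold constG46
  have h1 : K * K * c ≤ K' * K' * c := by gcongr
  have h2 : K * (K * (K * K * c) * c) * c ≤ K' * (K' * (K' * K' * c) * c) * c := by gcongr
  linarith

omit [Fintype X] [Fintype Y] [Fintype Z] [Fintype W] [Fintype g.Site] in
/-- The uniform bound of `constKp` along a family: with θ ≦ t and the smallness B₂θc² ≦ ½ (so (1 − B₂θc²)⁻¹ ≦ 2),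
`constKp B₂ B₄ θ c ≦ (B₂ + B₄) + (B₂ + B₄)·(t·2(B₂ + B₄)·c)·c`. [cite: Balaban1985BackgroundPropagators, Thm 3.13 p.426 (bookkeeping)] -/
theorem constKp_le {B₂ B₄ θ t c : ℝ} (hB₂ : 0 ≤ B₂) (hB₄ : 0 ≤ B₄) (hθ : 0 ≤ θ) (hθt : θ ≤ t) (hc : 0 ≤ c)
    (hq : B₂ * θ * c * c ≤ 1 / 2) :
    constKp B₂ B₄ θ c ≤ (B₂ + B₄) + (B₂ + B₄) * (t * (2 * (B₂ + B₄)) * c) * c := by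
  have hS0 : 0 ≤ B₂ + B₄ := add_nonneg hB₂ hB₄
  have ht : 0 ≤ t := hθ.trans hθt
  have hY0 : 0 ≤ (1 - B₂ * θ * c * c)⁻¹ := inv_nonneg.mpr (by linarith)
  have hY : (B₂ + B₄) * (1 - B₂ * θ * c * c)⁻¹ ≤ 2 * (B₂ + B₄) := const_le_two_mul hS0 hq
  have hSY0 : 0 ≤ (B₂ + B₄) * (1 - B₂ * θ * c * c)⁻¹ := mul_nonneg hS0 hY0
  have h1 : θ * ((B₂ + B₄) * (1 - B₂ * θ * c * c)⁻¹) * c ≤ t * (2 * (B₂ + B₄)) * c :=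
    mul_le_mul_of_nonneg_right (mul_le_mul hθt hY hSY0 ht) hc
  have h2 : (B₂ + B₄) * (θ * ((B₂ + B₄) * (1 - B₂ * θ * c * c)⁻¹) * c) * c ≤ (B₂ + B₄) * (t * (2 * (B₂ + B₄)) * c) * c :=
    mul_le_mul_of_nonneg_right (mul_le_mul_of_nonneg_left h1 hS0) hc
  unfold constKp constP
  linarith

omit [Fintype Z] [Fintype W] in
/-- **ONE ENTRY E·A·F OF A = G₀ + G₀TA IN THE WEIGHTED BLOCK-L² CLASSES** (r1-g6's `thm312_entry_l2` with the Neumann pair of classes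
W₁ = Lʲη, W₂ = (Lʲη)⁻¹ fixed by Theorem 3.3 (3.46)₀ for G₀ and the step's bound θ(Lʲη)⁻¹(L^{j′}η)⁻¹e^{−δd}, and W₁′ = Lʲη): from the
letters G₀F : W₀ → (Lʲη)⁻¹ (a_S), EG₀ : Lʲη → W₃ (a_E), EG₀F : W₀ → W₃ (a_EF), all at the rate δ with ρ + 2σ ≦ δ and B₂θc² < 1, the
majorant EAF : `l2w W₀ → l2w W₃`, constant `constP B₂ θ c a_S a_E a_EF`, rate ρ.
[cite: Balaban1985BackgroundPropagators, Thm 3.12 p.423 + (3.130) p.421 + (3.138) p.423 + (3.46) p.398; Balaban1984PropagatorsII, Lemma 2.1 (2.61) p.234] -/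
theorem entry_l2w_of_step (hG : GeoOK g) {𝔬 : Ops g B X Y Z W} {Lap : B.Cfg → Module.End ℝ (X → ℝ)} {U : B.Cfg}
    {T A : Module.End ℝ (X → ℝ)} {X₀ X₃ : Type} [Fintype X₀] [Fintype X₃] {blk₀ : X₀ → g.Site} {blk₃ : X₃ → g.Site}
    {W₀ W₃ : g.Site → ℝ} (hW₀ : ∀ y, 0 < W₀ y) (hW₃ : ∀ y, 0 < W₃ y)
    {Eop : (X → ℝ) →ₗ[ℝ] (X₃ → ℝ)} {Fop : (X₀ → ℝ) →ₗ[ℝ] (X → ℝ)} {B₂ θ δ ρ σ c aS aE aEF : ℝ}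
    (hrow : RowSum (toB6 g R₀ H₀) σ c) (hB₂ : 0 ≤ B₂) (hθ : 0 ≤ θ) (haS : 0 ≤ aS) (haE : 0 ≤ aE) (haEF : 0 ≤ aEF)
    (hρ : 0 ≤ ρ) (hσ : 0 ≤ σ) (hρδ : ρ + 2 * σ ≤ δ) (hL : Thm33G0L2 𝔬 Lap R₀ H₀ B₂ δ U)
    (hT : BlockBd (g := toB6 g R₀ H₀) 𝔬.blk 𝔬.blk T
      (fun (y y' : g.Site) => θ * (g.len y)⁻¹ * (g.len y')⁻¹ * Real.exp (-(δ * g.dist y y'))))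
    (hS : BlockBd (g := toB6 g R₀ H₀) blk₀ 𝔬.blk (𝔬.G0 U ∘ₗ Fop)
      (fun (y y' : g.Site) => g.len y * W₀ y' * (aS * Real.exp (-(δ * g.dist y y')))))
    (hE : BlockBd (g := toB6 g R₀ H₀) 𝔬.blk blk₃ (Eop ∘ₗ 𝔬.G0 U)
      (fun (y y' : g.Site) => (W₃ y)⁻¹ * g.len y' * (aE * Real.exp (-(δ * g.dist y y')))))
    (hEF : BlockBd (g := toB6 g R₀ H₀) blk₀ blk₃ (Eop ∘ₗ 𝔬.G0 U ∘ₗ Fop)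
      (fun (y y' : g.Site) => (W₃ y)⁻¹ * W₀ y' * (aEF * Real.exp (-(δ * g.dist y y')))))
    (hfix : A = 𝔬.G0 U + 𝔬.G0 U ∘ₗ T ∘ₗ A) (hq : B₂ * θ * c * c < 1) :
    HasMaj (l2w (toB6 g R₀ H₀) blk₀ W₀ fun y => (hW₀ y).le) (l2w (toB6 g R₀ H₀) blk₃ W₃ fun y => (hW₃ y).le)
      (Eop ∘ₗ A ∘ₗ Fop) (fun y y' => constP B₂ θ c aS aE aEF * Real.exp (-(ρ * g.dist y y'))) := by
  have htri : Triangle254 (toB6 g R₀ H₀) := fun a b c => hG.tri a b c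
  have hWl : ∀ y : g.Site, 0 < g.len y := hG.lenpos
  have hWi : ∀ y : g.Site, 0 < (g.len y)⁻¹ := fun y => inv_pos.mpr (hG.lenpos y)
  have h := thm312_entry_l2 (g := toB6 g R₀ H₀) (blk₀ := blk₀) (blk := 𝔬.blk) (blk₃ := blk₃)
    (W₀ := W₀) (W₁ := fun y => g.len y) (W₂ := fun y => (g.len y)⁻¹) (W₁' := fun y => g.len y) (W₃ := W₃)
    (G := A) (G0 := 𝔬.G0 U) (T' := T) (Eop := Eop) (Fop := Fop)
    (B := B₂) (θ := θ) (A := aS) (θ' := θ) (BE := aE) (AEF := aEF) hW₀ hWl hWi hWl hW₃ htri hG.dnn hrow hB₂ hθ haS hθ haE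
    haEF hρ hσ hρδ
    (hL.l0.mono fun y y' => le_of_eq (by simp only [inv_inv, toB6_dist]; ring))
    (hT.mono fun y y' => le_of_eq (by simp only [toB6_dist]; ring))
    (hS.mono fun y y' => le_of_eq (by simp only [inv_inv, toB6_dist]))
    (hT.mono fun y y' => le_of_eq (by simp only [toB6_dist]; ring))
    (hE.mono fun y y' => le_of_eq (by simp only [toB6_dist]))
    (hEF.mono fun y y' => le_of_eq (by simp only [toB6_dist]))
    (fix_mul_of_fix hfix) hq
  have h' := hasMaj_l2w_of_blockBd_ratio (g := toB6 g R₀ H₀) hW₀ hW₃ h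
  refine h'.mono fun y y' => le_of_eq ?_
  simp only [constP, toB6_dist]

omit [Fintype X] [Fintype Y] [Fintype Z] [Fintype W] in
/-- constant and rate weakening of an exponential majorant. [cite: Balaban1985BackgroundPropagators, (3.46) p.398 (bookkeeping)] -/
theorem hasMaj_up {F₁ F₂ : Type} [AddCommGroup F₁] [Module ℝ F₁] [AddCommGroup F₂] [Module ℝ F₂] (hG : GeoOK g)
    {b₁ : BlockNorm (toB6 g R₀ H₀) F₁} {b₂ : BlockNorm (toB6 g R₀ H₀) F₂} {T : F₁ →ₗ[ℝ] F₂} {a a' r r' : ℝ}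
    (ha : 0 ≤ a) (ha' : a ≤ a') (hr : r' ≤ r) (h : HasMaj b₁ b₂ T (fun y y' => a * Real.exp (-(r * g.dist y y')))) :
    HasMaj b₁ b₂ T (fun y y' => a' * Real.exp (-(r' * g.dist y y'))) :=
  h.mono fun y y' => mul_le_mul ha' (Real.exp_le_exp.mpr (neg_le_neg (mul_le_mul_of_nonneg_right hr (hG.dnn y y'))))
    (Real.exp_nonneg _) (ha.trans ha')

/-! ## §3 The three block-L² lines of 𝔊 = 𝔓G₁ -/

/-- ★ **(3.46)₄ FOR 𝔊 = 𝔓G₁ AS A BLOCK-L² BOUND** — ‖1_{Δ(y)}∇_U𝔊∇*_Uμ‖₂ ≦ K·e^{−ρd(y,y′)}‖μ‖₂ for supp μ ⊂ Δ(y′): (3.153) with E = ∇_U,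
F = ∇*_U (`E_GG_F_eq`), the G₁-entries ∇G₁∇*, ∇G₁D, ∇G₁Q*, G₁∇* by r1's Neumann bookkeeping from Theorem 3.3 for G₀ and the step
(`entry_l2w_of_step`), the letters RD*G₁∇*, C₁, Q (`Letters313L2`), composed by `hasMaj_frakG_classes` in the block-L² classes (all
cutting costs 1) with [4] (2.61) as the row sum; provisos ρ + 5σ ≦ δ, B₂θc² < 1; K = `constG46 (constKp B₂ B₄ θ c) c`.
[cite: Balaban1985BackgroundPropagators, Thm 3.13 p.426 + (3.153) p.426 + (3.46) p.398 + Thm 3.12 p.423; Balaban1984PropagatorsII, Lemma 2.1 (2.61) p.234] -/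
theorem GG_l2bd_entry4 (hG : GeoOK g) {𝔬 : Ops g B X Y Z W} {Lap : B.Cfg → Module.End ℝ (X → ℝ)} {U : B.Cfg}
    {B₂ B₄ θ δ ρ σ c : ℝ} (hrow : RowSum (toB6 g R₀ H₀) σ c) (hB₂ : 0 ≤ B₂) (hB₄ : 0 ≤ B₄) (hθ : 0 ≤ θ) (hρ : 0 ≤ ρ)
    (hσ : 0 ≤ σ) (hρδ : ρ + 5 * σ ≤ δ) (hL : Thm33G0L2 𝔬 Lap R₀ H₀ B₂ δ U)
    (hT : BlockBd (g := toB6 g R₀ H₀) 𝔬.blk 𝔬.blk (𝔬.Tpi U + 𝔬.T2 U)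
      (fun (y y' : g.Site) => θ * (g.len y)⁻¹ * (g.len y')⁻¹ * Real.exp (-(δ * g.dist y y'))))
    (hLt : Letters313L2 𝔬 Lap R₀ H₀ B₄ δ U) (hI : Identities 𝔬 U) (hq : B₂ * θ * c * c < 1) :
    BlockBd (g := toB6 g R₀ H₀) 𝔬.blkY 𝔬.blkY (𝔬.D U ∘ₗ (𝔬.GG U ∘ₗ 𝔬.Dstar U))
      (fun (y y' : g.Site) => constG46 (constKp B₂ B₄ θ c) c * Real.exp (-(ρ * g.dist y y'))) := by
  have hc : 0 ≤ c ∨ IsEmpty g.Site := by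
    by_cases hne : Nonempty g.Site
    · exact Or.inl (hrow.nonneg hne.some)
    · exact Or.inr (not_nonempty_iff.mp hne)
  rcases hc with hc | hemp
  swap
  · intro y' μ hμ y
    exact (hemp.false y).elim
  have htri : Triangle254 (toB6 g R₀ H₀) := fun a b c => hG.tri a b c
  have hW1 : ∀ y : g.Site, 0 < (fun _ : g.Site => (1 : ℝ)) y := fun _ => one_pos
  have hWl : ∀ y : g.Site, 0 < (fun y : g.Site => g.len y) y := fun y => hG.lenpos y
  have hWi : ∀ y : g.Site, 0 < (fun y : g.Site => (g.len y)⁻¹) y := fun y => inv_pos.mpr (hG.lenpos y)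
  have hfix : 𝔬.G1 U = 𝔬.G0 U + 𝔬.G0 U ∘ₗ (𝔬.Tpi U + 𝔬.T2 U) ∘ₗ 𝔬.G1 U := fix_of_inverses hI.invG0' hI.invG1
  -- constants
  have hS0 : 0 ≤ B₂ + B₄ := add_nonneg hB₂ hB₄
  have hS₂ : B₂ ≤ B₂ + B₄ := by linarith
  have hS₄ : B₄ ≤ B₂ + B₄ := by linarith
  obtain ⟨hKp0, -⟩ := constP_nonneg_le hθ hc hq hS0 hS0 hS0 le_rfl le_rfl le_rfl
  obtain ⟨hP₂0, hP₂le⟩ := constP_nonneg_le hθ hc hq hB₂ hB₂ hB₂ hS₂ hS₂ hS₂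
  obtain ⟨hP₄0, hP₄le⟩ := constP_nonneg_le hθ hc hq hB₄ hB₂ hB₄ hS₄ hS₂ hS₄
  have hB₄K : B₄ ≤ constP B₂ θ c (B₂ + B₄) (B₂ + B₄) (B₂ + B₄) := by
    have hq1 : 0 ≤ (1 - B₂ * θ * c * c)⁻¹ := inv_nonneg.mpr (by linarith)
    have h0 : 0 ≤ (B₂ + B₄) * (θ * ((B₂ + B₄) * (1 - B₂ * θ * c * c)⁻¹) * c) * c :=
      mul_nonneg (mul_nonneg hS0 (mul_nonneg (mul_nonneg hθ (mul_nonneg hS0 hq1)) hc)) hc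
    unfold constP; linarith
  have hKK0 : 0 ≤ constP B₂ θ c (B₂ + B₄) (B₂ + B₄) (B₂ + B₄) * constP B₂ θ c (B₂ + B₄) (B₂ + B₄) (B₂ + B₄) * c :=
    mul_nonneg (mul_nonneg hKp0 hKp0) hc
  -- rates
  have hr₁0 : 0 ≤ ρ + 3 * σ := by linarith
  have hr₁δ : ρ + 3 * σ + 2 * σ ≤ δ := by linarith
  have hr₂0 : 0 ≤ ρ + 2 * σ := by linarith
  have hr₂1 : ρ + 2 * σ ≤ ρ + 3 * σ := by linarith
  have hr₂δ' : ρ + 2 * σ + σ ≤ δ := by linarith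
  have hr₂δ : ρ + 2 * σ ≤ δ := by linarith
  have hρr₂ : ρ + 2 * σ ≤ ρ + 2 * σ := le_rfl
  -- the G₁-entries ∇G₁∇*, ∇G₁D, ∇G₁Q*, G₁∇* by r1's Neumann bookkeeping, at the rate ρ + 3σ
  have pG := entry_l2w_of_step hG hW1 hW1 (Eop := 𝔬.D U) (Fop := 𝔬.Dstar U) (aS := B₂) (aE := B₂) (aEF := B₂) hrow hB₂ hθ
    hB₂ hB₂ hB₂ hr₁0 hσ hr₁δ hL hT (hL.l2.mono fun y y' => le_of_eq (by ring)) (hL.l1.mono fun y y' => le_of_eq (by ring))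
    (hL.l4.mono fun y y' => le_of_eq (by ring)) hfix hq
  have pGD := entry_l2w_of_step hG hW1 hW1 (Eop := 𝔬.D U) (Fop := 𝔬.Dv U) (aS := B₄) (aE := B₂) (aEF := B₄) hrow hB₂ hθ
    hB₄ hB₂ hB₄ hr₁0 hσ hr₁δ hL hT (hLt.gDv.mono fun y y' => le_of_eq (by ring)) (hL.l1.mono fun y y' => le_of_eq (by ring))
    (hLt.dGDv.mono fun y y' => le_of_eq (by ring)) hfix hq
  have pGQ := entry_l2w_of_step hG hWl hW1 (Eop := 𝔬.D U) (Fop := 𝔬.Qstar U) (aS := B₄) (aE := B₂) (aEF := B₄) hrow hB₂ hθ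
    hB₄ hB₂ hB₄ hr₁0 hσ hr₁δ hL hT (hLt.gQs.mono fun y y' => le_of_eq (by ring)) (hL.l1.mono fun y y' => le_of_eq (by ring))
    (hLt.dGQs.mono fun y y' => le_of_eq (by ring)) hfix hq
  have pGDs := entry_l2w_of_step hG hW1 hWi (Eop := LinearMap.id) (Fop := 𝔬.Dstar U) (aS := B₂) (aE := B₂) (aEF := B₂) hrow
    hB₂ hθ hB₂ hB₂ hB₂ hr₁0 hσ hr₁δ hL hT (hL.l2.mono fun y y' => le_of_eq (by ring))
    (by rw [LinearMap.id_comp]; exact hL.l0.mono fun y y' => le_of_eq (by rw [inv_inv]; ring))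
    (by rw [LinearMap.id_comp]; exact hL.l2.mono fun y y' => le_of_eq (by rw [inv_inv]; ring)) hfix hq
  rw [LinearMap.id_comp] at pGDs
  -- the letters RD*G₁∇*, C₁, Q in the block-L² classes
  have pRG : HasMaj (l2w (toB6 g R₀ H₀) 𝔬.blkY (fun _ : g.Site => (1 : ℝ)) fun y => (hW1 y).le)
      (l2w (toB6 g R₀ H₀) 𝔬.blkW (fun _ : g.Site => (1 : ℝ)) fun y => (hW1 y).le)
      (𝔬.R U ∘ₗ 𝔬.Dvstar U ∘ₗ 𝔬.G1 U ∘ₗ 𝔬.Dstar U) (fun y y' => B₄ * Real.exp (-(δ * g.dist y y'))) :=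
    hasMaj_l2w_of_blockBd_ratio (g := toB6 g R₀ H₀) hW1 hW1 (hLt.rgdDs.mono fun y y' => le_of_eq (by ring))
  have pC : HasMaj (l2w (toB6 g R₀ H₀) 𝔬.blkZ (fun y : g.Site => (g.len y)⁻¹) fun y => (hWi y).le)
      (l2w (toB6 g R₀ H₀) 𝔬.blkZ (fun y : g.Site => g.len y) fun y => (hWl y).le)
      (𝔬.C1 U) (fun y y' => B₄ * Real.exp (-(δ * g.dist y y'))) :=
    hasMaj_l2w_of_blockBd_ratio (g := toB6 g R₀ H₀) hWi hWl (hLt.c1.mono fun y y' => le_of_eq (by ring))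
  have pQ : HasMaj (l2w (toB6 g R₀ H₀) 𝔬.blk (fun y : g.Site => (g.len y)⁻¹) fun y => (hWi y).le)
      (l2w (toB6 g R₀ H₀) 𝔬.blkZ (fun y : g.Site => (g.len y)⁻¹) fun y => (hWi y).le)
      (𝔬.Q U) (fun y y' => B₄ * Real.exp (-(δ * g.dist y y'))) :=
    hasMaj_l2w_of_blockBd_ratio (g := toB6 g R₀ H₀) hWi hWi (hLt.q.mono fun y y' => le_of_eq (by rw [inv_inv]; ring))
  -- QG₁∇* at the rate ρ + 2σ
  have pQG := hasMaj_comp_exp htri hG.dnn hrow hB₄ hP₂0 hr₂0 hr₂1 hr₂δ' pQ pGDs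
  simp only [l2w_κ, one_mul] at pQG
  -- everything at (K_p, ρ + 2σ), the composite at K_p²c
  have uG := hasMaj_up hG hP₂0 hP₂le hr₂1 pG
  have uGD := hasMaj_up hG hP₄0 hP₄le hr₂1 pGD
  have uRG := hasMaj_up hG hB₄ hB₄K hr₂δ pRG
  have uGQ := hasMaj_up hG hP₄0 hP₄le hr₂1 pGQ
  have uC := hasMaj_up hG hB₄ hB₄K hr₂δ pC
  have uQG := hasMaj_up hG (mul_nonneg (mul_nonneg hB₄ hP₂0) hc)
    (mul_le_mul_of_nonneg_right (mul_le_mul hB₄K hP₂le hP₂0 hKp0) hc) hρr₂ pQG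
  -- (3.153) composed in the block-L² classes
  have hfr := hasMaj_frakG_classes htri hG.dnn hrow hKp0 hKp0 hKp0 hKp0 hKp0 hKK0 hρ hσ hρr₂ uG uGD uRG uGQ uC uQG
  have hGG := hfr.congr (T' := 𝔬.D U ∘ₗ (𝔬.GG U ∘ₗ 𝔬.Dstar U)) fun μ => by rw [E_GG_F_eq hI (𝔬.D U) (𝔬.Dstar U)]
  have hbd := blockBd_of_hasMaj_l2w hGG hW1
  refine hbd.mono fun y y' => le_of_eq ?_
  simp only [l2w_κ, one_mul, toB6_dist, constG46, constKp, mul_one, div_one]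

/-- ★ **(3.46)₃ FOR 𝔊 = 𝔓G₁ AS A BLOCK-L² BOUND** — ‖1_{Δ(y)}Δ_U𝔊λ‖₂ ≦ K·Λ·e^{−(ρ−αρ₀)d(y,y′)}‖λ‖₂ for supp λ ⊂ Δ(y′): (3.153) with E = Δ_U
(`E_GG_eq`), the G₁-entries Δ_UG₁, Δ_UG₁D, Δ_UG₁Q*, G₁ from Theorem 3.3 for G₀ and the step (`entry_l2w_of_step`), the letters RD*G₁,
C₁, Q, composed by `hasMaj_frakG_classes` in the block-L² classes Lʲη → Lʲη (which carries the ratio L^{j′}η∕Lʲη), then the scale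
transfer (2.60) of p. 398 (`blockBd_transfer`, constant Λ, rate loss αρ₀); provisos ρ + 5σ ≦ δ, B₂θc² < 1.
[cite: Balaban1985BackgroundPropagators, Thm 3.13 p.426 + (3.153) p.426 + (3.46) p.398 + p.398 (remark after (3.47)); Balaban1984PropagatorsII, Lemma 2.1 (2.60)–(2.61) p.234] -/
theorem GG_l2bd_entry3 (hG : GeoOK g) {𝔬 : Ops g B X Y Z W} {Lap : B.Cfg → Module.End ℝ (X → ℝ)} {U : B.Cfg}
    {B₂ B₄ θ δ ρ ρ₀ α Λ σ c : ℝ} (hrow : RowSum (toB6 g R₀ H₀) σ c) (hB₂ : 0 ≤ B₂) (hB₄ : 0 ≤ B₄) (hθ : 0 ≤ θ) (hρ : 0 ≤ ρ)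
    (hσ : 0 ≤ σ) (hρδ : ρ + 5 * σ ≤ δ) (hST : ScaleTransfer g ρ₀ α Λ (fun y => g.len y ^ (1 : ℝ)))
    (hL : Thm33G0L2 𝔬 Lap R₀ H₀ B₂ δ U)
    (hT : BlockBd (g := toB6 g R₀ H₀) 𝔬.blk 𝔬.blk (𝔬.Tpi U + 𝔬.T2 U)
      (fun (y y' : g.Site) => θ * (g.len y)⁻¹ * (g.len y')⁻¹ * Real.exp (-(δ * g.dist y y'))))
    (hLt : Letters313L2 𝔬 Lap R₀ H₀ B₄ δ U) (hI : Identities 𝔬 U) (hq : B₂ * θ * c * c < 1) :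
    BlockBd (g := toB6 g R₀ H₀) 𝔬.blk 𝔬.blk (Lap U ∘ₗ 𝔬.GG U)
      (fun (y y' : g.Site) => constG46 (constKp B₂ B₄ θ c) c * Λ * Real.exp (-((ρ - α * ρ₀) * g.dist y y'))) := by
  have hc : 0 ≤ c ∨ IsEmpty g.Site := by
    by_cases hne : Nonempty g.Site
    · exact Or.inl (hrow.nonneg hne.some)
    · exact Or.inr (not_nonempty_iff.mp hne)
  rcases hc with hc | hemp
  swap
  · intro y' μ hμ y
    exact (hemp.false y).elim
  have htri : Triangle254 (toB6 g R₀ H₀) := fun a b c => hG.tri a b c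
  have hW1 : ∀ y : g.Site, 0 < (fun _ : g.Site => (1 : ℝ)) y := fun _ => one_pos
  have hWl : ∀ y : g.Site, 0 < (fun y : g.Site => g.len y) y := fun y => hG.lenpos y
  have hWi : ∀ y : g.Site, 0 < (fun y : g.Site => (g.len y)⁻¹) y := fun y => inv_pos.mpr (hG.lenpos y)
  have hfix : 𝔬.G1 U = 𝔬.G0 U + 𝔬.G0 U ∘ₗ (𝔬.Tpi U + 𝔬.T2 U) ∘ₗ 𝔬.G1 U := fix_of_inverses hI.invG0' hI.invG1
  -- constants
  have hS0 : 0 ≤ B₂ + B₄ := add_nonneg hB₂ hB₄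
  have hS₂ : B₂ ≤ B₂ + B₄ := by linarith
  have hS₄ : B₄ ≤ B₂ + B₄ := by linarith
  obtain ⟨hKp0, -⟩ := constP_nonneg_le hθ hc hq hS0 hS0 hS0 le_rfl le_rfl le_rfl
  obtain ⟨hP₂0, hP₂le⟩ := constP_nonneg_le hθ hc hq hB₂ hB₂ hB₂ hS₂ hS₂ hS₂
  obtain ⟨hP₄0, hP₄le⟩ := constP_nonneg_le hθ hc hq hB₄ hB₂ hB₄ hS₄ hS₂ hS₄
  have hB₄K : B₄ ≤ constP B₂ θ c (B₂ + B₄) (B₂ + B₄) (B₂ + B₄) := by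
    have hq1 : 0 ≤ (1 - B₂ * θ * c * c)⁻¹ := inv_nonneg.mpr (by linarith)
    have h0 : 0 ≤ (B₂ + B₄) * (θ * ((B₂ + B₄) * (1 - B₂ * θ * c * c)⁻¹) * c) * c :=
      mul_nonneg (mul_nonneg hS0 (mul_nonneg (mul_nonneg hθ (mul_nonneg hS0 hq1)) hc)) hc
    unfold constP; linarith
  have hKK0 : 0 ≤ constP B₂ θ c (B₂ + B₄) (B₂ + B₄) (B₂ + B₄) * constP B₂ θ c (B₂ + B₄) (B₂ + B₄) (B₂ + B₄) * c :=
    mul_nonneg (mul_nonneg hKp0 hKp0) hc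
  have hKG0 : 0 ≤ constG46 (constKp B₂ B₄ θ c) c := constG46_nonneg hKp0 hc
  -- rates
  have hr₁0 : 0 ≤ ρ + 3 * σ := by linarith
  have hr₁δ : ρ + 3 * σ + 2 * σ ≤ δ := by linarith
  have hr₂0 : 0 ≤ ρ + 2 * σ := by linarith
  have hr₂1 : ρ + 2 * σ ≤ ρ + 3 * σ := by linarith
  have hr₂δ' : ρ + 2 * σ + σ ≤ δ := by linarith
  have hr₂δ : ρ + 2 * σ ≤ δ := by linarith
  have hρr₂ : ρ + 2 * σ ≤ ρ + 2 * σ := le_rfl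
  -- the G₁-entries Δ_UG₁, Δ_UG₁D, Δ_UG₁Q*, G₁ by r1's Neumann bookkeeping, at the rate ρ + 3σ
  have pG := entry_l2w_of_step hG hWl hWl (Eop := Lap U) (Fop := LinearMap.id) (aS := B₂) (aE := B₂) (aEF := B₂) hrow hB₂
    hθ hB₂ hB₂ hB₂ hr₁0 hσ hr₁δ hL hT (by rw [LinearMap.comp_id]; exact hL.l0.mono fun y y' => le_of_eq (by ring))
    (hL.l3.mono fun y y' => le_of_eq (by ring))
    (by rw [LinearMap.comp_id]; exact hL.l3.mono fun y y' => le_of_eq (by ring)) hfix hq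
  have pGD := entry_l2w_of_step hG hW1 hWl (Eop := Lap U) (Fop := 𝔬.Dv U) (aS := B₄) (aE := B₂) (aEF := B₄) hrow hB₂ hθ
    hB₄ hB₂ hB₄ hr₁0 hσ hr₁δ hL hT (hLt.gDv.mono fun y y' => le_of_eq (by ring)) (hL.l3.mono fun y y' => le_of_eq (by ring))
    (hLt.lapGDv.mono fun y y' => le_of_eq (by ring)) hfix hq
  have pGQ := entry_l2w_of_step hG hWl hWl (Eop := Lap U) (Fop := 𝔬.Qstar U) (aS := B₄) (aE := B₂) (aEF := B₄) hrow hB₂ hθ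
    hB₄ hB₂ hB₄ hr₁0 hσ hr₁δ hL hT (hLt.gQs.mono fun y y' => le_of_eq (by ring)) (hL.l3.mono fun y y' => le_of_eq (by ring))
    (hLt.lapGQs.mono fun y y' => le_of_eq (by ring)) hfix hq
  have pG1 := entry_l2w_of_step hG hWl hWi (Eop := LinearMap.id) (Fop := LinearMap.id) (aS := B₂) (aE := B₂) (aEF := B₂)
    hrow hB₂ hθ hB₂ hB₂ hB₂ hr₁0 hσ hr₁δ hL hT
    (by rw [LinearMap.comp_id]; exact hL.l0.mono fun y y' => le_of_eq (by ring))
    (by rw [LinearMap.id_comp]; exact hL.l0.mono fun y y' => le_of_eq (by rw [inv_inv]; ring))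
    (by rw [LinearMap.id_comp, LinearMap.comp_id]; exact hL.l0.mono fun y y' => le_of_eq (by rw [inv_inv]; ring)) hfix hq
  rw [LinearMap.id_comp] at pG1
  -- the letters RD*G₁, C₁, Q in the block-L² classes
  have pRG : HasMaj (l2w (toB6 g R₀ H₀) 𝔬.blk (fun y : g.Site => g.len y) fun y => (hWl y).le)
      (l2w (toB6 g R₀ H₀) 𝔬.blkW (fun _ : g.Site => (1 : ℝ)) fun y => (hW1 y).le)
      (𝔬.R U ∘ₗ 𝔬.Dvstar U ∘ₗ 𝔬.G1 U ∘ₗ LinearMap.id) (fun y y' => B₄ * Real.exp (-(δ * g.dist y y'))) :=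
    hasMaj_l2w_of_blockBd_ratio (g := toB6 g R₀ H₀) hWl hW1 (hLt.rgdI.mono fun y y' => le_of_eq (by ring))
  have pC : HasMaj (l2w (toB6 g R₀ H₀) 𝔬.blkZ (fun y : g.Site => (g.len y)⁻¹) fun y => (hWi y).le)
      (l2w (toB6 g R₀ H₀) 𝔬.blkZ (fun y : g.Site => g.len y) fun y => (hWl y).le)
      (𝔬.C1 U) (fun y y' => B₄ * Real.exp (-(δ * g.dist y y'))) :=
    hasMaj_l2w_of_blockBd_ratio (g := toB6 g R₀ H₀) hWi hWl (hLt.c1.mono fun y y' => le_of_eq (by ring))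
  have pQ : HasMaj (l2w (toB6 g R₀ H₀) 𝔬.blk (fun y : g.Site => (g.len y)⁻¹) fun y => (hWi y).le)
      (l2w (toB6 g R₀ H₀) 𝔬.blkZ (fun y : g.Site => (g.len y)⁻¹) fun y => (hWi y).le)
      (𝔬.Q U) (fun y y' => B₄ * Real.exp (-(δ * g.dist y y'))) :=
    hasMaj_l2w_of_blockBd_ratio (g := toB6 g R₀ H₀) hWi hWi (hLt.q.mono fun y y' => le_of_eq (by rw [inv_inv]; ring))
  -- QG₁ at the rate ρ + 2σ
  have pQG := hasMaj_comp_exp htri hG.dnn hrow hB₄ hP₂0 hr₂0 hr₂1 hr₂δ' pQ pG1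
  simp only [l2w_κ, one_mul] at pQG
  -- everything at (K_p, ρ + 2σ), the composite at K_p²c
  have uG := hasMaj_up hG hP₂0 hP₂le hr₂1 pG
  have uGD := hasMaj_up hG hP₄0 hP₄le hr₂1 pGD
  have uRG := hasMaj_up hG hB₄ hB₄K hr₂δ pRG
  have uGQ := hasMaj_up hG hP₄0 hP₄le hr₂1 pGQ
  have uC := hasMaj_up hG hB₄ hB₄K hr₂δ pC
  have uQG := hasMaj_up hG (mul_nonneg (mul_nonneg hB₄ hP₂0) hc)
    (mul_le_mul_of_nonneg_right (mul_le_mul hB₄K hP₂le hP₂0 hKp0) hc) hρr₂ pQG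
  -- (3.153) composed in the block-L² classes, then unweighted and transferred
  have hfr := hasMaj_frakG_classes htri hG.dnn hrow hKp0 hKp0 hKp0 hKp0 hKp0 hKK0 hρ hσ hρr₂ uG uGD uRG uGQ uC uQG
  have hGG := hfr.congr (T' := Lap U ∘ₗ 𝔬.GG U) fun μ => by rw [E_GG_eq hI (Lap U)]
  have hbd := blockBd_of_hasMaj_l2w hGG hWl
  have h' : BlockBd (g := toB6 g R₀ H₀) 𝔬.blk 𝔬.blk (Lap U ∘ₗ 𝔬.GG U)
      (fun (y y' : g.Site) => constG46 (constKp B₂ B₄ θ c) c * (g.len y' ^ (1 : ℝ) * (g.len y ^ (1 : ℝ))⁻¹) *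
        Real.exp (-(ρ * g.dist y y'))) :=
    hbd.mono fun y y' => le_of_eq (by
      simp only [l2w_κ, one_mul, toB6_dist, constG46, constKp, Real.rpow_one, div_eq_mul_inv]; ring)
  exact blockBd_transfer (C := fun _ _ => constG46 (constKp B₂ B₄ θ c) c) (fun _ _ => hKG0)
    (fun z => Real.rpow_pos_of_pos (hG.lenpos z) 1) hST h'

/-- ★ **(3.46)₅ FOR 𝔊 = 𝔓G₁ AS A BLOCK-L² BOUND** — ‖1_{Δ(y)}𝔊Δ_Uλ‖₂ ≦ K·Λ′·e^{−(ρ−αρ₀)d(y,y′)}‖λ‖₂ for supp λ ⊂ Δ(y′): (3.153) with F = Δ_U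
(`B9Thm313Whole.GG_comp_eq`), the G₁-entries G₁Δ_U, G₁D, G₁Q* from Theorem 3.3 for G₀ and the step (`entry_l2w_of_step`), the letters
RD*G₁Δ_U, C₁, Q, composed by `hasMaj_frakG_classes` in the block-L² classes (Lʲη)⁻¹ → (Lʲη)⁻¹ (which carries the ratio Lʲη∕L^{j′}η), then
the scale transfer (2.60) at the weight (Lʲη)⁻¹ (constant Λ′, rate loss αρ₀); provisos ρ + 5σ ≦ δ, B₂θc² < 1.
[cite: Balaban1985BackgroundPropagators, Thm 3.13 p.426 + (3.153) p.426 + (3.46) p.398 + p.398 (remark after (3.47)); Balaban1984PropagatorsII, Lemma 2.1 (2.60)–(2.61) p.234] -/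
theorem GG_l2bd_entry5 (hG : GeoOK g) {𝔬 : Ops g B X Y Z W} {Lap : B.Cfg → Module.End ℝ (X → ℝ)} {U : B.Cfg}
    {B₂ B₄ θ δ ρ ρ₀ α Λ σ c : ℝ} (hrow : RowSum (toB6 g R₀ H₀) σ c) (hB₂ : 0 ≤ B₂) (hB₄ : 0 ≤ B₄) (hθ : 0 ≤ θ) (hρ : 0 ≤ ρ)
    (hσ : 0 ≤ σ) (hρδ : ρ + 5 * σ ≤ δ) (hST : ScaleTransfer g ρ₀ α Λ (fun y => g.len y ^ (-1 : ℝ)))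
    (hL : Thm33G0L2 𝔬 Lap R₀ H₀ B₂ δ U)
    (hT : BlockBd (g := toB6 g R₀ H₀) 𝔬.blk 𝔬.blk (𝔬.Tpi U + 𝔬.T2 U)
      (fun (y y' : g.Site) => θ * (g.len y)⁻¹ * (g.len y')⁻¹ * Real.exp (-(δ * g.dist y y'))))
    (hLt : Letters313L2 𝔬 Lap R₀ H₀ B₄ δ U) (hI : Identities 𝔬 U) (hq : B₂ * θ * c * c < 1) :
    BlockBd (g := toB6 g R₀ H₀) 𝔬.blk 𝔬.blk (𝔬.GG U ∘ₗ Lap U)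
      (fun (y y' : g.Site) => constG46 (constKp B₂ B₄ θ c) c * Λ * Real.exp (-((ρ - α * ρ₀) * g.dist y y'))) := by
  have hc : 0 ≤ c ∨ IsEmpty g.Site := by
    by_cases hne : Nonempty g.Site
    · exact Or.inl (hrow.nonneg hne.some)
    · exact Or.inr (not_nonempty_iff.mp hne)
  rcases hc with hc | hemp
  swap
  · intro y' μ hμ y
    exact (hemp.false y).elim
  have htri : Triangle254 (toB6 g R₀ H₀) := fun a b c => hG.tri a b c
  have hW1 : ∀ y : g.Site, 0 < (fun _ : g.Site => (1 : ℝ)) y := fun _ => one_pos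
  have hWl : ∀ y : g.Site, 0 < (fun y : g.Site => g.len y) y := fun y => hG.lenpos y
  have hWi : ∀ y : g.Site, 0 < (fun y : g.Site => (g.len y)⁻¹) y := fun y => inv_pos.mpr (hG.lenpos y)
  have hfix : 𝔬.G1 U = 𝔬.G0 U + 𝔬.G0 U ∘ₗ (𝔬.Tpi U + 𝔬.T2 U) ∘ₗ 𝔬.G1 U := fix_of_inverses hI.invG0' hI.invG1
  -- constants
  have hS0 : 0 ≤ B₂ + B₄ := add_nonneg hB₂ hB₄
  have hS₂ : B₂ ≤ B₂ + B₄ := by linarith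
  have hS₄ : B₄ ≤ B₂ + B₄ := by linarith
  obtain ⟨hKp0, -⟩ := constP_nonneg_le hθ hc hq hS0 hS0 hS0 le_rfl le_rfl le_rfl
  obtain ⟨hP₂0, hP₂le⟩ := constP_nonneg_le hθ hc hq hB₂ hB₂ hB₂ hS₂ hS₂ hS₂
  obtain ⟨hP₄0, hP₄le⟩ := constP_nonneg_le hθ hc hq hB₄ hB₂ hB₄ hS₄ hS₂ hS₄
  have hB₄K : B₄ ≤ constP B₂ θ c (B₂ + B₄) (B₂ + B₄) (B₂ + B₄) := by
    have hq1 : 0 ≤ (1 - B₂ * θ * c * c)⁻¹ := inv_nonneg.mpr (by linarith)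
    have h0 : 0 ≤ (B₂ + B₄) * (θ * ((B₂ + B₄) * (1 - B₂ * θ * c * c)⁻¹) * c) * c :=
      mul_nonneg (mul_nonneg hS0 (mul_nonneg (mul_nonneg hθ (mul_nonneg hS0 hq1)) hc)) hc
    unfold constP; linarith
  have hKK0 : 0 ≤ constP B₂ θ c (B₂ + B₄) (B₂ + B₄) (B₂ + B₄) * constP B₂ θ c (B₂ + B₄) (B₂ + B₄) (B₂ + B₄) * c :=
    mul_nonneg (mul_nonneg hKp0 hKp0) hc
  have hKG0 : 0 ≤ constG46 (constKp B₂ B₄ θ c) c := constG46_nonneg hKp0 hc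
  -- rates
  have hr₁0 : 0 ≤ ρ + 3 * σ := by linarith
  have hr₁δ : ρ + 3 * σ + 2 * σ ≤ δ := by linarith
  have hr₂0 : 0 ≤ ρ + 2 * σ := by linarith
  have hr₂1 : ρ + 2 * σ ≤ ρ + 3 * σ := by linarith
  have hr₂δ' : ρ + 2 * σ + σ ≤ δ := by linarith
  have hr₂δ : ρ + 2 * σ ≤ δ := by linarith
  have hρr₂ : ρ + 2 * σ ≤ ρ + 2 * σ := le_rfl
  -- the G₁-entries G₁Δ_U, G₁D, G₁Q* by r1's Neumann bookkeeping, at the rate ρ + 3σ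
  have pG := entry_l2w_of_step hG hWi hWi (Eop := LinearMap.id) (Fop := Lap U) (aS := B₂) (aE := B₂) (aEF := B₂) hrow hB₂
    hθ hB₂ hB₂ hB₂ hr₁0 hσ hr₁δ hL hT (hL.l5.mono fun y y' => le_of_eq (by ring))
    (by rw [LinearMap.id_comp]; exact hL.l0.mono fun y y' => le_of_eq (by rw [inv_inv]; ring))
    (by rw [LinearMap.id_comp]; exact hL.l5.mono fun y y' => le_of_eq (by rw [inv_inv]; ring)) hfix hq
  rw [LinearMap.id_comp] at pG
  have pGD := entry_l2w_of_step hG hW1 hWi (Eop := LinearMap.id) (Fop := 𝔬.Dv U) (aS := B₄) (aE := B₂) (aEF := B₄) hrow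
    hB₂ hθ hB₄ hB₂ hB₄ hr₁0 hσ hr₁δ hL hT (hLt.gDv.mono fun y y' => le_of_eq (by ring))
    (by rw [LinearMap.id_comp]; exact hL.l0.mono fun y y' => le_of_eq (by rw [inv_inv]; ring))
    (by rw [LinearMap.id_comp]; exact hLt.gDv.mono fun y y' => le_of_eq (by rw [inv_inv]; ring)) hfix hq
  rw [LinearMap.id_comp] at pGD
  have pGQ := entry_l2w_of_step hG hWl hWi (Eop := LinearMap.id) (Fop := 𝔬.Qstar U) (aS := B₄) (aE := B₂) (aEF := B₄) hrow
    hB₂ hθ hB₄ hB₂ hB₄ hr₁0 hσ hr₁δ hL hT (hLt.gQs.mono fun y y' => le_of_eq (by ring))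
    (by rw [LinearMap.id_comp]; exact hL.l0.mono fun y y' => le_of_eq (by rw [inv_inv]; ring))
    (by rw [LinearMap.id_comp]; exact hLt.gQs.mono fun y y' => le_of_eq (by rw [inv_inv]; ring)) hfix hq
  rw [LinearMap.id_comp] at pGQ
  -- the letters RD*G₁Δ_U, C₁, Q in the block-L² classes
  have pRG : HasMaj (l2w (toB6 g R₀ H₀) 𝔬.blk (fun y : g.Site => (g.len y)⁻¹) fun y => (hWi y).le)
      (l2w (toB6 g R₀ H₀) 𝔬.blkW (fun _ : g.Site => (1 : ℝ)) fun y => (hW1 y).le)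
      (𝔬.R U ∘ₗ 𝔬.Dvstar U ∘ₗ 𝔬.G1 U ∘ₗ Lap U) (fun y y' => B₄ * Real.exp (-(δ * g.dist y y'))) :=
    hasMaj_l2w_of_blockBd_ratio (g := toB6 g R₀ H₀) hWi hW1 (hLt.rgdLap.mono fun y y' => le_of_eq (by ring))
  have pC : HasMaj (l2w (toB6 g R₀ H₀) 𝔬.blkZ (fun y : g.Site => (g.len y)⁻¹) fun y => (hWi y).le)
      (l2w (toB6 g R₀ H₀) 𝔬.blkZ (fun y : g.Site => g.len y) fun y => (hWl y).le)
      (𝔬.C1 U) (fun y y' => B₄ * Real.exp (-(δ * g.dist y y'))) :=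
    hasMaj_l2w_of_blockBd_ratio (g := toB6 g R₀ H₀) hWi hWl (hLt.c1.mono fun y y' => le_of_eq (by ring))
  have pQ : HasMaj (l2w (toB6 g R₀ H₀) 𝔬.blk (fun y : g.Site => (g.len y)⁻¹) fun y => (hWi y).le)
      (l2w (toB6 g R₀ H₀) 𝔬.blkZ (fun y : g.Site => (g.len y)⁻¹) fun y => (hWi y).le)
      (𝔬.Q U) (fun y y' => B₄ * Real.exp (-(δ * g.dist y y'))) :=
    hasMaj_l2w_of_blockBd_ratio (g := toB6 g R₀ H₀) hWi hWi (hLt.q.mono fun y y' => le_of_eq (by rw [inv_inv]; ring))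
  -- QG₁Δ_U at the rate ρ + 2σ
  have pQG := hasMaj_comp_exp htri hG.dnn hrow hB₄ hP₂0 hr₂0 hr₂1 hr₂δ' pQ pG
  simp only [l2w_κ, one_mul] at pQG
  -- everything at (K_p, ρ + 2σ), the composite at K_p²c
  have uG := hasMaj_up hG hP₂0 hP₂le hr₂1 pG
  have uGD := hasMaj_up hG hP₄0 hP₄le hr₂1 pGD
  have uRG := hasMaj_up hG hB₄ hB₄K hr₂δ pRG
  have uGQ := hasMaj_up hG hP₄0 hP₄le hr₂1 pGQ
  have uC := hasMaj_up hG hB₄ hB₄K hr₂δ pC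
  have uQG := hasMaj_up hG (mul_nonneg (mul_nonneg hB₄ hP₂0) hc)
    (mul_le_mul_of_nonneg_right (mul_le_mul hB₄K hP₂le hP₂0 hKp0) hc) hρr₂ pQG
  -- (3.153) composed in the block-L² classes, then unweighted and transferred
  have hfr := hasMaj_frakG_classes htri hG.dnn hrow hKp0 hKp0 hKp0 hKp0 hKp0 hKK0 hρ hσ hρr₂ uG uGD uRG uGQ uC uQG
  have hGG := hfr.congr (T' := 𝔬.GG U ∘ₗ Lap U) fun μ => by rw [GG_comp_eq hI (Lap U)]
  have hbd := blockBd_of_hasMaj_l2w hGG hWi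
  have h' : BlockBd (g := toB6 g R₀ H₀) 𝔬.blk 𝔬.blk (𝔬.GG U ∘ₗ Lap U)
      (fun (y y' : g.Site) => constG46 (constKp B₂ B₄ θ c) c * (g.len y' ^ (-1 : ℝ) * (g.len y ^ (-1 : ℝ))⁻¹) *
        Real.exp (-(ρ * g.dist y y'))) :=
    hbd.mono fun y y' => le_of_eq (by
      simp only [l2w_κ, one_mul, toB6_dist, constG46, constKp, Real.rpow_neg_one, div_eq_mul_inv]; ring)
  exact blockBd_transfer (C := fun _ _ => constG46 (constKp B₂ B₄ θ c) c) (fun _ _ => hKG0)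
    (fun z => Real.rpow_pos_of_pos (hG.lenpos z) (-1)) hST h'

end L2G

end

end Literature.MathematicalPhysics.QuantumFieldTheory.Balaban1983to89.B9Thm313WholeL2G
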